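import Mathlib
import HarnessLib
import Literature.MathematicalPhysics.StatisticalMechanics.LennardJonesClusters

/-!
# FrustratedLawDichotomy · `TexturedLawTransfer` (stmt-AtomisticToContinuum-27625) · registered stub `stub_folnerRadius`
(LINE «truncated-bs», decomp-a2c lens 2 «structural dichotomy», generation 13)

**Følner radii with thick thin shells (ground-state-free hard-core combinatorics).**  For every `δ > 0` there are functions
`Ls, εs : ℝ → ℝ` with `Ls R → ∞`, `εs R → 0` such that every `δ`-separated finite configuration `y : Fin N → ℝ³`, every centre
`i` and every `R ≥ 0` admit a radius `r ∈ [R/4, R/2]` whose outer shell `{j : r − Ls R < |y j − y i| ≤ r}` holds at most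
`εs R · #{j : |y j − y i| ≤ r}` particles.

Proof.  FIXED PARAMETERS (`folner_fixed`): for `ε > 0`, `L > 0` and `R ≥ 4·L·M·n₀` (`M = ⌈1/ε⌉₊ + 1`), if each of the
`K = ⌊R/(4L)⌋₊` candidate radii `r_k = R/4 + kL` failed, the ball counts `b_k = #B(y i, r_k)` would satisfy
`b_{k+1} > (1+ε) b_k`, so `(1+ε)^K ≤ b_K`, while packing (`card_le_of_separated_of_dist_le`) gives `b_K ≤ (R/δ + 1)³ < (C(n+1))³`
with `n = K / M`, `C = 4LM/δ + 1`, and `(1+ε)^K ≥ ((1+ε)^M)^n ≥ 2^n` (Bernoulli); `(C(n+1))³ < 2^n` for `n ≥ n₀`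
(`tendsto_pow_const_div_const_pow_of_one_lt`) is the contradiction.  DIAGONALISATION: with thresholds `R₀ n` for
`(ε, L) = (1/(n+1), n+1)`, the monotone majorant `T n = n + Σ_{m ≤ n} |R₀ m|` and `Ns R = findGreatest {n ≤ ⌊R⌋₊ : T n ≤ R}`,
put `Ls R = Ns R + 1`, `εs R = 1/(Ns R + 1)` (both packaged as existentials inside the proof; the file declares no `def`).
-/

noncomputable section

namespace Summit.AtomisticToContinuum.Crystallization.Theorems.FrustratedLawDichotomyFolnerRadius

open Filter Topology

variable {N : ℕ}

/-- Ball counts are monotone in the radius. [folklore] -/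
theorem ball_card_mono (y : Fin N → EuclideanSpace ℝ (Fin 3)) (i : Fin N) {r r' : ℝ} (h : r ≤ r') :
    (Finset.univ.filter (fun j : Fin N => dist (y j) (y i) ≤ r)).card ≤ (Finset.univ.filter (fun j : Fin N => dist (y j) (y i) ≤ r')).card :=
  Finset.card_le_card (fun j hj => by
    simp only [Finset.mem_filter, Finset.mem_univ, true_and] at hj ⊢
    exact hj.trans h)

/-- The centre itself lies in every ball of non-negative radius. [folklore] -/
theorem one_le_ball_card (y : Fin N → EuclideanSpace ℝ (Fin 3)) (i : Fin N) {r : ℝ} (hr : 0 ≤ r) :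
    1 ≤ (Finset.univ.filter (fun j : Fin N => dist (y j) (y i) ≤ r)).card := by
  rw [Nat.one_le_iff_ne_zero, ← Nat.pos_iff_ne_zero, Finset.card_pos]
  exact ⟨i, by simp [hr]⟩

/-- The outer shell count is the difference of two ball counts. [folklore] -/
theorem shell_card_eq (y : Fin N → EuclideanSpace ℝ (Fin 3)) (i : Fin N) {r' r : ℝ} (h : r' ≤ r) :
    ((Finset.univ.filter (fun j : Fin N => r' < dist (y j) (y i) ∧ dist (y j) (y i) ≤ r)).card : ℝ)
      = ((Finset.univ.filter (fun j : Fin N => dist (y j) (y i) ≤ r)).card : ℝ)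
        - ((Finset.univ.filter (fun j : Fin N => dist (y j) (y i) ≤ r')).card : ℝ) := by
  have hsub : (Finset.univ.filter (fun j : Fin N => dist (y j) (y i) ≤ r')) ⊆
      (Finset.univ.filter (fun j : Fin N => dist (y j) (y i) ≤ r)) := fun j hj => by
    simp only [Finset.mem_filter, Finset.mem_univ, true_and] at hj ⊢
    exact hj.trans h
  have hset : (Finset.univ.filter (fun j : Fin N => r' < dist (y j) (y i) ∧ dist (y j) (y i) ≤ r)) =
      (Finset.univ.filter (fun j : Fin N => dist (y j) (y i) ≤ r)) \
        (Finset.univ.filter (fun j : Fin N => dist (y j) (y i) ≤ r')) := by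
    ext j
    simp only [Finset.mem_filter, Finset.mem_univ, true_and, Finset.mem_sdiff, not_le]
    tauto
  have hadd := Finset.card_sdiff_add_card_eq_card hsub
  rw [hset, eq_sub_iff_add_eq]
  exact_mod_cast hadd

/-- Packing bound for a `δ`-separated configuration. [folklore] -/
theorem ball_card_le_packing (y : Fin N → EuclideanSpace ℝ (Fin 3)) {δ : ℝ} (hδ : 0 < δ)
    (hsep : ∀ a b : Fin N, a ≠ b → δ ≤ dist (y a) (y b)) (i : Fin N) {r : ℝ} (hr : 0 ≤ r) :
    ((Finset.univ.filter (fun j : Fin N => dist (y j) (y i) ≤ r)).card : ℝ) ≤ (2 * r / δ + 1) ^ 3 := by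
  classical
  have hinj : Function.Injective y := fun a b hab => by
    by_contra hne
    have h1 := hsep a b hne
    rw [hab, dist_self] at h1
    linarith
  set F := Finset.univ.filter (fun j : Fin N => dist (y j) (y i) ≤ r) with hF
  have h := Literature.MathematicalPhysics.StatisticalMechanics.card_le_of_separated_of_dist_le
    (F.image y) (y i) hδ hr ?_ ?_
  · rw [finrank_euclideanSpace_fin, Finset.card_image_of_injective _ hinj] at h
    exact_mod_cast h
  · intro p hp
    obtain ⟨j, hj, rfl⟩ := Finset.mem_image.1 hp
    exact (Finset.mem_filter.1 hj).2
  · intro p hp q hq hpq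
    obtain ⟨j, -, rfl⟩ := Finset.mem_image.1 hp
    obtain ⟨k, -, rfl⟩ := Finset.mem_image.1 hq
    exact hsep j k (fun hjk => hpq (hjk ▸ rfl))

/-- Exponential beats cubic: `(C(n+1))³ < 2ⁿ` eventually. [folklore] -/
theorem eventually_cube_lt_two_pow (C : ℝ) :
    ∃ n₀ : ℕ, ∀ n : ℕ, n₀ ≤ n → (C * ((n : ℝ) + 1)) ^ 3 < (2 : ℝ) ^ n := by
  have ht := tendsto_pow_const_div_const_pow_of_one_lt 3 (one_lt_two : (1 : ℝ) < 2)
  have hKpos : (0 : ℝ) < 8 * |C| ^ 3 + 1 := by positivity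
  have hpos : (0 : ℝ) < 1 / (8 * |C| ^ 3 + 1) := by positivity
  obtain ⟨n₁, hn₁⟩ := eventually_atTop.1 ((tendsto_order.1 ht).2 _ hpos)
  refine ⟨max n₁ 1, fun n hn => ?_⟩
  have hn1 : (1 : ℝ) ≤ n := by exact_mod_cast le_of_max_le_right hn
  have h := hn₁ n (le_of_max_le_left hn)
  have h2pos : (0 : ℝ) < 2 ^ n := by positivity
  have h' : (8 * |C| ^ 3 + 1) * (n : ℝ) ^ 3 < 2 ^ n := by
    have h3 : (n : ℝ) ^ 3 < 1 / (8 * |C| ^ 3 + 1) * 2 ^ n := (div_lt_iff₀ h2pos).mp h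
    calc (8 * |C| ^ 3 + 1) * (n : ℝ) ^ 3 < (8 * |C| ^ 3 + 1) * (1 / (8 * |C| ^ 3 + 1) * 2 ^ n) :=
          mul_lt_mul_of_pos_left h3 hKpos
      _ = 2 ^ n := by field_simp
  have hC3 : C ^ 3 ≤ |C| ^ 3 := by
    calc C ^ 3 ≤ |C ^ 3| := le_abs_self _
      _ = |C| ^ 3 := abs_pow C 3
  have hn1' : ((n : ℝ) + 1) ^ 3 ≤ (2 * n) ^ 3 :=
    pow_le_pow_left₀ (by positivity) (by linarith) 3
  have hn3 : (0 : ℝ) ≤ (n : ℝ) ^ 3 := by positivity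
  calc (C * ((n : ℝ) + 1)) ^ 3 = C ^ 3 * ((n : ℝ) + 1) ^ 3 := by ring
    _ ≤ |C| ^ 3 * (2 * n) ^ 3 := mul_le_mul hC3 hn1' (by positivity) (by positivity)
    _ = 8 * |C| ^ 3 * (n : ℝ) ^ 3 := by ring
    _ ≤ (8 * |C| ^ 3 + 1) * (n : ℝ) ^ 3 := by nlinarith
    _ < 2 ^ n := h'

/-- FIXED PARAMETERS: for `ε, L > 0` and `R` beyond an explicit threshold, one of the radii `R/4 + kL ≤ R/2` has an
`ε`-thin outer `L`-shell. [folklore] -/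
theorem folner_fixed {δ : ℝ} (hδ : 0 < δ) {ε : ℝ} (hε : 0 < ε) {L : ℝ} (hL : 0 < L) :
    ∃ R₀ : ℝ, ∀ R : ℝ, R₀ ≤ R → ∀ (N : ℕ) (y : Fin N → EuclideanSpace ℝ (Fin 3)) (i : Fin N),
      (∀ a b : Fin N, a ≠ b → δ ≤ dist (y a) (y b)) →
      ∃ r : ℝ, R / 4 ≤ r ∧ r ≤ R / 2 ∧
        ((Finset.univ.filter (fun j : Fin N => r - L < dist (y j) (y i) ∧ dist (y j) (y i) ≤ r)).card : ℝ)
          ≤ ε * ((Finset.univ.filter (fun j : Fin N => dist (y j) (y i) ≤ r)).card : ℝ) := by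
  set M : ℕ := ⌈1 / ε⌉₊ + 1 with hM
  have hMpos : 0 < M := Nat.succ_pos _
  have hMε : 2 ≤ 1 + (M : ℝ) * ε := by
    have h1 : 1 / ε ≤ (⌈1 / ε⌉₊ : ℝ) := Nat.le_ceil _
    have h2 : (M : ℝ) = (⌈1 / ε⌉₊ : ℝ) + 1 := by simp [hM]
    have h3 : 1 / ε * ε = 1 := one_div_mul_cancel hε.ne'
    rw [h2]
    nlinarith
  set C : ℝ := 4 * L * M / δ + 1 with hC
  obtain ⟨n₀, hn₀⟩ := eventually_cube_lt_two_pow C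
  refine ⟨4 * L * M * n₀, fun R hR N y i hsep => ?_⟩
  have hLM : (0 : ℝ) ≤ 4 * L * M * n₀ := by positivity
  have hR0 : 0 ≤ R := hLM.trans hR
  have hR4L : 0 ≤ R / (4 * L) := by positivity
  set K : ℕ := ⌊R / (4 * L)⌋₊ with hK
  set n : ℕ := K / M with hn
  have hKle : (K : ℝ) ≤ R / (4 * L) := Nat.floor_le hR4L
  have hKL : (K : ℝ) * L ≤ R / 4 := by
    have := mul_le_mul_of_nonneg_right hKle hL.le
    calc (K : ℝ) * L ≤ R / (4 * L) * L := this
      _ = R / 4 := by field_simp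
  -- n₀ ≤ n
  have hn₀n : n₀ ≤ n := by
    rw [hn, Nat.le_div_iff_mul_le hMpos, hK, Nat.le_floor_iff hR4L]
    rw [le_div_iff₀ (by positivity)]
    push_cast
    nlinarith
  -- R < 4 L M (n+1)
  have hRlt : R < 4 * L * M * ((n : ℝ) + 1) := by
    have h1 : R / (4 * L) < (K : ℝ) + 1 := Nat.lt_floor_add_one _
    have h2 : K < n * M + M := by
      have := Nat.lt_div_mul_add (a := K) hMpos
      simpa [hn] using this
    have h3 : (K : ℝ) + 1 ≤ ((n : ℝ) + 1) * M := by
      have : K + 1 ≤ (n + 1) * M := by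
        have : (n + 1) * M = n * M + M := by ring
        omega
      exact_mod_cast this
    have h4 : R / (4 * L) < ((n : ℝ) + 1) * M := lt_of_lt_of_le h1 h3
    rw [div_lt_iff₀ (by positivity)] at h4
    linarith
  -- suppose every candidate radius fails
  by_contra H0
  have H : ∀ r : ℝ, R / 4 ≤ r → r ≤ R / 2 →
      ε * ((Finset.univ.filter (fun j : Fin N => dist (y j) (y i) ≤ r)).card : ℝ) <
        ((Finset.univ.filter (fun j : Fin N => r - L < dist (y j) (y i) ∧ dist (y j) (y i) ≤ r)).card : ℝ) :=
    fun r h1 h2 => not_le.mp fun h => H0 ⟨r, h1, h2, h⟩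
  -- ball counts along the candidate radii
  set b : ℕ → ℝ := fun k => ((Finset.univ.filter (fun j : Fin N => dist (y j) (y i) ≤ R / 4 + k * L)).card : ℝ) with hb
  have hb_mono : ∀ k : ℕ, b k ≤ b (k + 1) := fun k => by
    simp only [hb]
    exact_mod_cast ball_card_mono y i (by push_cast; nlinarith)
  have hstep : ∀ k : ℕ, k + 1 ≤ K → (1 + ε) * b k ≤ b (k + 1) := by
    intro k hk
    have hk' : ((k : ℝ) + 1) * L ≤ R / 4 := by
      have : ((k : ℝ) + 1) ≤ K := by exact_mod_cast hk
      nlinarith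
    have hr1 : R / 4 ≤ R / 4 + ((k : ℝ) + 1) * L := by nlinarith
    have hr2 : R / 4 + ((k : ℝ) + 1) * L ≤ R / 2 := by linarith
    have hH := H (R / 4 + ((k : ℝ) + 1) * L) hr1 hr2
    rw [shell_card_eq y i (by nlinarith : R / 4 + ((k : ℝ) + 1) * L - L ≤ R / 4 + ((k : ℝ) + 1) * L)] at hH
    have e1 : R / 4 + ((k : ℝ) + 1) * L - L = R / 4 + (k : ℝ) * L := by ring
    rw [e1] at hH
    have hbk : b k = ((Finset.univ.filter (fun j : Fin N => dist (y j) (y i) ≤ R / 4 + (k : ℝ) * L)).card : ℝ) := rfl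
    have hbk1 : b (k + 1) = ((Finset.univ.filter (fun j : Fin N => dist (y j) (y i) ≤ R / 4 + ((k : ℝ) + 1) * L)).card : ℝ) := by
      simp only [hb]; push_cast; ring_nf
    rw [hbk, hbk1]
    have hm := hb_mono k
    rw [hbk, hbk1] at hm
    nlinarith
  have hgrow : ∀ k : ℕ, k ≤ K → (1 + ε) ^ k ≤ b k := by
    intro k
    induction k with
    | zero =>
      intro _
      simp only [pow_zero, hb, Nat.cast_zero, zero_mul, add_zero]
      exact_mod_cast one_le_ball_card y i (by positivity : (0 : ℝ) ≤ R / 4)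
    | succ k ih =>
      intro hk
      have h1 := ih (Nat.le_of_succ_le hk)
      have h2 := hstep k hk
      have h3 : (0 : ℝ) ≤ 1 + ε := by positivity
      calc (1 + ε) ^ (k + 1) = (1 + ε) * (1 + ε) ^ k := by ring
        _ ≤ (1 + ε) * b k := mul_le_mul_of_nonneg_left h1 h3
        _ ≤ b (k + 1) := h2
  -- lower end: 2^n ≤ (1+ε)^K
  have hlow : (2 : ℝ) ^ n ≤ (1 + ε) ^ K := by
    have h1 : (2 : ℝ) ≤ (1 + ε) ^ M := by
      have := one_add_mul_le_pow (show (-2 : ℝ) ≤ ε by linarith) M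
      linarith
    have h2 : (2 : ℝ) ^ n ≤ ((1 + ε) ^ M) ^ n := pow_le_pow_left₀ (by norm_num) h1 n
    have h3 : ((1 + ε) ^ M) ^ n = (1 + ε) ^ (n * M) := by rw [← pow_mul, mul_comm]
    have h4 : (1 + ε) ^ (n * M) ≤ (1 + ε) ^ K :=
      pow_le_pow_right₀ (by linarith) (by rw [hn]; exact Nat.div_mul_le_self K M)
    linarith [h3 ▸ h2]
  -- upper end: b K ≤ (R/δ + 1)^3 < (C (n+1))^3 < 2^n
  have hup : b K ≤ (R / δ + 1) ^ 3 := by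
    have h1 : (0 : ℝ) ≤ R / 4 + (K : ℝ) * L := by positivity
    have h2 := ball_card_le_packing y hδ hsep i h1
    have h3 : 2 * (R / 4 + (K : ℝ) * L) / δ + 1 ≤ R / δ + 1 := by
      have : 2 * (R / 4 + (K : ℝ) * L) ≤ R := by linarith
      have := div_le_div_of_nonneg_right this hδ.le
      linarith
    have h4 : (0 : ℝ) ≤ 2 * (R / 4 + (K : ℝ) * L) / δ + 1 := by positivity
    calc b K = ((Finset.univ.filter (fun j : Fin N => dist (y j) (y i) ≤ R / 4 + (K : ℝ) * L)).card : ℝ) := rfl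
      _ ≤ (2 * (R / 4 + (K : ℝ) * L) / δ + 1) ^ 3 := h2
      _ ≤ (R / δ + 1) ^ 3 := pow_le_pow_left₀ h4 h3 3
  have hC1 : R / δ + 1 < C * ((n : ℝ) + 1) := by
    have h1 : R / δ < 4 * L * M * ((n : ℝ) + 1) / δ := div_lt_div_of_pos_right hRlt hδ
    have h2 : (1 : ℝ) ≤ (n : ℝ) + 1 := by
      have : (0 : ℝ) ≤ n := Nat.cast_nonneg n
      linarith
    have h3 : (0 : ℝ) ≤ 4 * L * M / δ := by positivity
    calc R / δ + 1 < 4 * L * M * ((n : ℝ) + 1) / δ + 1 := by linarith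
      _ ≤ 4 * L * M * ((n : ℝ) + 1) / δ + ((n : ℝ) + 1) := by linarith
      _ = C * ((n : ℝ) + 1) := by rw [hC]; ring
  have hC2 : (R / δ + 1) ^ 3 < (C * ((n : ℝ) + 1)) ^ 3 :=
    pow_lt_pow_left₀ hC1 (by positivity) (by norm_num)
  have hfin := hn₀ n hn₀n
  have hall : (2 : ℝ) ^ n < 2 ^ n :=
    calc (2 : ℝ) ^ n ≤ (1 + ε) ^ K := hlow
      _ ≤ b K := hgrow K le_rfl
      _ ≤ (R / δ + 1) ^ 3 := hup
      _ < (C * ((n : ℝ) + 1)) ^ 3 := hC2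
      _ < 2 ^ n := hfin
  exact lt_irrefl _ hall

/-- **Registered stub `stub_folnerRadius` of LINE «truncated-bs» on `FrustratedLawDichotomy.TexturedLawTransfer`
(stmt-AtomisticToContinuum-27625), BY NAME AND SIGNATURE.** [folklore] -/
theorem stub_folnerRadius :
    ∀ δ : ℝ, 0 < δ → ∃ Ls εs : ℝ → ℝ, Filter.Tendsto Ls Filter.atTop Filter.atTop ∧ Filter.Tendsto εs Filter.atTop (nhds 0) ∧ ∀ (R : ℝ) (N : ℕ) (y : Fin N → EuclideanSpace ℝ (Fin 3)) (i : Fin N), 0 ≤ R → (∀ a b : Fin N, a ≠ b → δ ≤ dist (y a) (y b)) → ∃ r : ℝ, R / 4 ≤ r ∧ r ≤ R / 2 ∧ (((Finset.univ.filter (fun j : Fin N => r - Ls R < dist (y j) (y i) ∧ dist (y j) (y i) ≤ r))).card : ℝ) ≤ εs R * (((Finset.univ.filter (fun j : Fin N => dist (y j) (y i) ≤ r))).card : ℝ) := by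
  intro δ hδ
  have hQ : ∀ n : ℕ, ∃ R₀ : ℝ, ∀ R : ℝ, R₀ ≤ R → ∀ (N : ℕ) (y : Fin N → EuclideanSpace ℝ (Fin 3)) (i : Fin N),
      (∀ a b : Fin N, a ≠ b → δ ≤ dist (y a) (y b)) →
      ∃ r : ℝ, R / 4 ≤ r ∧ r ≤ R / 2 ∧
        ((Finset.univ.filter (fun j : Fin N => r - ((n : ℝ) + 1) < dist (y j) (y i) ∧ dist (y j) (y i) ≤ r)).card : ℝ)
          ≤ 1 / ((n : ℝ) + 1) * ((Finset.univ.filter (fun j : Fin N => dist (y j) (y i) ≤ r)).card : ℝ) :=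
    fun n => folner_fixed hδ (by positivity) (by positivity)
  choose R₀ hR₀ using hQ
  -- monotone majorant `T n = n + Σ_{m ≤ n} |R₀ m|`
  obtain ⟨T, hT₁, hT₂, hT₃⟩ : ∃ T : ℕ → ℝ, (∀ n : ℕ, R₀ n ≤ T n) ∧ (∀ n : ℕ, (n : ℝ) ≤ T n) ∧ Monotone T := by
    refine ⟨fun n : ℕ => (n : ℝ) + ∑ m ∈ Finset.range (n + 1), |R₀ m|, fun n => ?_, fun n => ?_, ?_⟩
    · show R₀ n ≤ (n : ℝ) + ∑ m ∈ Finset.range (n + 1), |R₀ m|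
      have h1 : |R₀ n| ≤ ∑ m ∈ Finset.range (n + 1), |R₀ m| :=
        Finset.single_le_sum (f := fun m => |R₀ m|) (fun m _ => abs_nonneg _) (Finset.self_mem_range_succ n)
      have h2 : (0 : ℝ) ≤ n := Nat.cast_nonneg n
      linarith [le_abs_self (R₀ n)]
    · show (n : ℝ) ≤ (n : ℝ) + ∑ m ∈ Finset.range (n + 1), |R₀ m|
      have : (0 : ℝ) ≤ ∑ m ∈ Finset.range (n + 1), |R₀ m| := Finset.sum_nonneg (fun m _ => abs_nonneg _)
      linarith
    · refine monotone_nat_of_le_succ fun n => ?_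
      show (n : ℝ) + ∑ m ∈ Finset.range (n + 1), |R₀ m| ≤
        ((n + 1 : ℕ) : ℝ) + ∑ m ∈ Finset.range (n + 1 + 1), |R₀ m|
      rw [Finset.sum_range_succ (fun m => |R₀ m|) (n + 1)]
      have h1 : (0 : ℝ) ≤ |R₀ (n + 1)| := abs_nonneg _
      push_cast
      linarith
  -- selected index `Ns R` = the largest `n ≤ ⌊R⌋₊` with `T n ≤ R`
  classical
  obtain ⟨Ns, hN₁, hN₂, hN₃⟩ : ∃ Ns : ℝ → ℕ, (∀ (n : ℕ) (R : ℝ), T n ≤ R → n ≤ Ns R) ∧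
      (∀ R : ℝ, T 0 ≤ R → T (Ns R) ≤ R) ∧ (∀ R : ℝ, ¬ T 0 ≤ R → Ns R = 0) := by
    refine ⟨fun R => Nat.findGreatest (fun n => T n ≤ R) ⌊R⌋₊, fun n R h => ?_, fun R h0 => ?_,
      fun R h0 => ?_⟩
    · exact Nat.le_findGreatest (Nat.le_floor ((hT₂ n).trans h)) h
    · exact Nat.findGreatest_spec (P := fun n => T n ≤ R) (Nat.zero_le _) h0
    · show Nat.findGreatest (fun n => T n ≤ R) ⌊R⌋₊ = 0
      rw [Nat.findGreatest_eq_zero_iff]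
      intro n _ _ hn
      exact h0 ((hT₃ (Nat.zero_le n)).trans hn)
  have hNs : Tendsto Ns atTop atTop := tendsto_atTop_atTop.2 fun n => ⟨T n, fun R hR => hN₁ n R hR⟩
  refine ⟨fun R => (Ns R : ℝ) + 1, fun R => 1 / ((Ns R : ℝ) + 1), ?_, ?_, ?_⟩
  · exact tendsto_atTop_add_const_right _ _ (tendsto_natCast_atTop_atTop.comp hNs)
  · exact (tendsto_one_div_add_atTop_nhds_zero_nat (𝕜 := ℝ)).comp hNs
  · intro R N y i hR hsep
    by_cases h0 : T 0 ≤ R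
    · exact hR₀ (Ns R) R ((hT₁ _).trans (hN₂ R h0)) N y i hsep
    · have hz : Ns R = 0 := hN₃ R h0
      refine ⟨R / 4, le_rfl, by linarith, ?_⟩
      beta_reduce
      rw [hz]
      simp only [Nat.cast_zero, zero_add, div_one, one_mul]
      exact_mod_cast Finset.card_le_card (fun j hj => by
        simp only [Finset.mem_filter, Finset.mem_univ, true_and] at hj ⊢
        exact hj.2)

end Summit.AtomisticToContinuum.Crystallization.Theorems.FrustratedLawDichotomyFolnerRadius

end
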